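import Mathlib.MeasureTheory.Integral.IntervalIntegral.Basic
import Mathlib.MeasureTheory.Integral.IntervalIntegral.FundThmCalculus
import Mathlib.MeasureTheory.Integral.Bochner.Set
import Mathlib.Analysis.SpecialFunctions.ExpDeriv
import HarnessLib

/-!
# A Grönwall-type damping lemma from a.e. two-point integral inequalities

Topic `Literature/Analysis/ODE` (namespace `Literature.Analysis.ODE`). Real-variable proof-support (everything proved; no definitions, no named facts).  If a nonnegative integrable
function `u` on `(0,T)` satisfies, for all `s ≤ t` in a set `S` of full measure,
`u(t) − u(s) ≤ ∫_{(s,t]} (K − λ u)` and `u(t) ≤ ∫_{(0,t]} (K − λ u)` (`λ > 0`, `K ≥ 0`), then `u ≤ K/λ` on `S`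
(`le_div_of_two_point_setIntegral_le`).  This is the integral (absolutely-continuous-free) form of
`u' ≤ K − λu, u(0) = 0 ⇒ u ≤ K/λ` (Grönwall, Evans App. B.2), stated for functions known only almost everywhere —
the form in which the Galerkin energy identities of weak solutions deliver it.  Consumer: the FAST-BLOCK energy bound
of weak passive-vector solutions along a cell carrier (clause (C) of the K1L tensor cell package, cell `ad-ideate`).

## References

* L. C. Evans, *Partial Differential Equations*, 2nd ed. (AMS 2010), App. B.2 (Grönwall's inequality). [`Evans2010`]
-/

noncomputable section

open MeasureTheory Set Filter

namespace Literature.Analysis.ODE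

/-- On a subinterval `(s,t] ⊆ (0,T)`, an a.e. statement on `(0,T)` holds a.e. [cite: Evans2010, App. B.2 (Grönwall's inequality)] -/
theorem ae_restrict_Ioc_of_ae_restrict_Ioo {T s t : ℝ} (hs : 0 ≤ s) (ht : t < T) {P : ℝ → Prop}
    (h : ∀ᵐ r ∂(volume.restrict (Ioo 0 T)), P r) : ∀ᵐ r ∂(volume.restrict (Ioc s t)), P r :=
  ae_restrict_of_ae_restrict_of_subset
    (show Ioc s t ⊆ Ioo 0 T from fun _ hr => ⟨hs.trans_lt hr.1, hr.2.trans_lt ht⟩) h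

/-- **Damping from two-point integral inequalities (a.e. Grönwall).**  Let `u ≥ 0` be integrable on `(0,T)`, `S ⊆ (0,T)`
of full measure, `0 < λ`, `0 ≤ K`, and suppose `u(t) ≤ ∫_{(0,t]} (K − λu)` for `t ∈ S` and
`u(t) − u(s) ≤ ∫_{(s,t]} (K − λu)` for `s ≤ t` in `S`.  Then `u(t) ≤ K/λ` for every `t ∈ S`.
(Above the level `K/λ` the integrand is negative; run the two-point inequality from the last time below the level.)
[cite: Evans2010, App. B.2 (Grönwall's inequality)] -/
theorem le_div_of_two_point_setIntegral_le {u : ℝ → ℝ} {S : Set ℝ} {T K lam : ℝ} (hlam : 0 < lam) (hK : 0 ≤ K)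
    (hSsub : S ⊆ Ioo 0 T) (hS : ∀ᵐ r ∂(volume.restrict (Ioo 0 T)), r ∈ S)
    (hu0 : ∀ r ∈ S, 0 ≤ u r) (hint : IntegrableOn u (Ioo 0 T))
    (h0 : ∀ t ∈ S, u t ≤ ∫ r in Ioc 0 t, (K - lam * u r))
    (h2 : ∀ s ∈ S, ∀ t ∈ S, s ≤ t → u t - u s ≤ ∫ r in Ioc s t, (K - lam * u r)) :
    ∀ t ∈ S, u t ≤ K / lam := by
  intro t₁ ht₁
  by_contra hgt
  push Not at hgt
  have ht₁T : t₁ < T := (hSsub ht₁).2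
  have ht₁0 : 0 < t₁ := (hSsub ht₁).1
  have hS' : ∀ᵐ r ∂(volume : Measure ℝ), r ∈ Ioo 0 T → r ∈ S := (ae_restrict_iff' measurableSet_Ioo).1 hS
  -- integrability of the integrand on subintervals
  have hI : ∀ s t, 0 ≤ s → t < T → IntegrableOn (fun r => K - lam * u r) (Ioc s t) := by
    intro s t hs ht
    have hsub : Ioc s t ⊆ Ioo 0 T := fun r hr => ⟨hs.trans_lt hr.1, hr.2.trans_lt ht⟩
    exact (integrableOn_const (by simp [Real.volume_Ioc]) ).sub ((hint.mono_set hsub).const_mul lam) |>.congr_fun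
      (fun r _ => rfl) measurableSet_Ioc
  -- the integrand is `≤ K` a.e. and `< 0` a.e. where `u > K/λ`
  have hleK : ∀ s t, 0 ≤ s → t < T → ∫ r in Ioc s t, (K - lam * u r) ≤ K * (t - s) ⊔ 0 := by
    intro s t hs ht
    by_cases hst : s ≤ t
    · have h1 : ∫ r in Ioc s t, (K - lam * u r) ≤ ∫ r in Ioc s t, K := by
        refine setIntegral_mono_ae_restrict (hI s t hs ht) (integrableOn_const (by simp [Real.volume_Ioc])) ?_
        filter_upwards [ae_restrict_Ioc_of_ae_restrict_Ioo hs ht hS] with r hr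
        have := hu0 r hr
        nlinarith
      rw [setIntegral_const, Real.volume_real_Ioc_of_le hst, smul_eq_mul, mul_comm] at h1
      exact h1.trans (le_max_left _ _)
    · rw [Ioc_eq_empty (fun h => hst h.le), Measure.restrict_empty, integral_zero_measure]
      exact le_max_right _ _
  -- the set of times `≤ t₁` in `S` where `u ≤ K/λ`
  set A : Set ℝ := {s | s ∈ S ∧ s ≤ t₁ ∧ u s ≤ K / lam} with hA
  by_cases hAne : A.Nonempty
  · -- run from the last time below the level
    have hAbdd : BddAbove A := ⟨t₁, fun s hs => hs.2.1⟩
    set sStar := sSup A with hsStar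
    have hsStar_le : sStar ≤ t₁ := csSup_le hAne fun s hs => hs.2.1
    have hsStar_nn : 0 ≤ sStar := by
      obtain ⟨a, ha⟩ := hAne
      exact (hSsub ha.1).1.le.trans (le_csSup hAbdd ha)
    -- above `sStar` (and `≤ t₁`) the function exceeds the level, a.e.
    have hneg : ∫ r in Ioc sStar t₁, (K - lam * u r) ≤ 0 := by
      refine setIntegral_nonpos_ae measurableSet_Ioc ?_
      filter_upwards [hS'] with r hrS' hr
      have hrS : r ∈ S := hrS' ⟨hsStar_nn.trans_lt hr.1, hr.2.trans_lt ht₁T⟩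
      have hnot : ¬ (u r ≤ K / lam) := by
        intro hle
        have hrA : r ∈ A := ⟨hrS, hr.2, hle⟩
        exact (not_le.2 hr.1) (le_csSup hAbdd hrA)
      push Not at hnot
      have : K < lam * u r := by rwa [div_lt_iff₀ hlam, mul_comm] at hnot
      linarith
    -- for every `s ∈ A`: `u t₁ ≤ K/λ + K (sStar - s)`
    have hkey : ∀ s ∈ A, u t₁ ≤ K / lam + K * (sStar - s) := by
      intro s hs
      have hsS : s ∈ S := hs.1
      have hs0 : 0 ≤ s := (hSsub hsS).1.le
      have hssStar : s ≤ sStar := le_csSup hAbdd hs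
      have h := h2 s hsS t₁ ht₁ hs.2.1
      have hsplit : ∫ r in Ioc s t₁, (K - lam * u r) =
          (∫ r in Ioc s sStar, (K - lam * u r)) + ∫ r in Ioc sStar t₁, (K - lam * u r) := by
        rw [← setIntegral_union (Ioc_disjoint_Ioc_of_le le_rfl) measurableSet_Ioc
          (hI s sStar hs0 (hsStar_le.trans_lt ht₁T)) (hI sStar t₁ hsStar_nn ht₁T),
          Ioc_union_Ioc_eq_Ioc hssStar hsStar_le]
      have h1 := hleK s sStar hs0 (hsStar_le.trans_lt ht₁T)
      have hmax : K * (sStar - s) ⊔ 0 = K * (sStar - s) := max_eq_left (mul_nonneg hK (by linarith))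
      rw [hmax] at h1
      have := hs.2.2
      linarith [hsplit ▸ h]
    -- let `s → sStar` inside `A`
    have hlim : u t₁ ≤ K / lam := by
      by_contra hc
      push Not at hc
      -- choose `s ∈ A` with `K (sStar - s) < u t₁ - K/λ`
      by_cases hK0 : K = 0
      · obtain ⟨a, ha⟩ := hAne
        have := hkey a ha
        rw [hK0, zero_mul, add_zero] at this
        rw [hK0] at hc
        linarith
      · have hKpos : 0 < K := lt_of_le_of_ne hK (Ne.symm hK0)
        set ε := (u t₁ - K / lam) / K with hε
        have hεpos : 0 < ε := div_pos (by linarith) hKpos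
        obtain ⟨s, hsA, hs⟩ := exists_lt_of_lt_csSup hAne (sub_lt_self sStar hεpos)
        have := hkey s hsA
        have hlt : K * (sStar - s) < K * ε := mul_lt_mul_of_pos_left (by linarith) hKpos
        have hKε : K * ε = u t₁ - K / lam := by rw [hε]; field_simp
        linarith
    exact (not_lt.2 hlim) hgt
  · -- no time `≤ t₁` below the level: the integrand is negative a.e. on `(0,t₁]`
    have hneg : ∫ r in Ioc 0 t₁, (K - lam * u r) ≤ 0 := by
      refine setIntegral_nonpos_ae measurableSet_Ioc ?_
      filter_upwards [hS'] with r hrS' hr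
      have hrS : r ∈ S := hrS' ⟨hr.1, hr.2.trans_lt ht₁T⟩
      have hnot : ¬ (u r ≤ K / lam) := fun hle => hAne ⟨r, hrS, hr.2, hle⟩
      push Not at hnot
      have : K < lam * u r := by rwa [div_lt_iff₀ hlam, mul_comm] at hnot
      linarith
    have := h0 t₁ ht₁
    have hKl : 0 ≤ K / lam := div_nonneg hK hlam.le
    linarith


/-! ## Amendment 1 (lead-k1l-onelevel-p1 g0, 2026-08-28): the exponential envelope — initial value and decay

The same mechanism with an initial value: `u(t) − u₀ ≤ ∫_{(0,t]} (K − λu)`, `u₀ ≤ K/λ + c` and the two-point inequalities give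
`u(t) ≤ K/λ + c·e^{−λt}` — above the moving level `ψ(t) = K/λ + c e^{−λt}` the integrand is below `ψ' = −λ c e^{−λt}`, so the
two-point inequality run from the last time below the envelope cannot cross it.  Stated on `(0,T]` (closed at `T`) so that
consumers may evaluate at the right end point of a window.  Consumer: the two-scale slow/fast leakage lemma
(`TwoScaleLeakageGronwall`) behind clause (F_T) of the K1L tensor cell package. -/

/-- `∫_{(a,b]} (−λ c e^{−λ r}) dr = c e^{−λ b} − c e^{−λ a}` (`a ≤ b`). [cite: Evans2010, App. B.2 (Grönwall's inequality)] -/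
theorem setIntegral_Ioc_neg_mul_exp {lam c a b : ℝ} (hab : a ≤ b) :
    ∫ r in Ioc a b, -(lam * c * Real.exp (-lam * r)) = c * Real.exp (-lam * b) - c * Real.exp (-lam * a) := by
  rw [← intervalIntegral.integral_of_le hab]
  have hderiv : ∀ r ∈ uIcc a b, HasDerivAt (fun r => c * Real.exp (-lam * r)) (-(lam * c * Real.exp (-lam * r))) r := by
    intro r _
    have h1 : HasDerivAt (fun r : ℝ => -lam * r) (-lam) r := by
      simpa using (hasDerivAt_id r).const_mul (-lam)
    have h2 := (h1.exp).const_mul c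
    have e : c * (Real.exp (-lam * r) * -lam) = -(lam * c * Real.exp (-lam * r)) := by ring
    rw [e] at h2
    exact h2
  have hcont : Continuous fun r : ℝ => -(lam * c * Real.exp (-lam * r)) :=
    (continuous_const.mul (Real.continuous_exp.comp (continuous_const.mul continuous_id))).neg
  rw [intervalIntegral.integral_eq_sub_of_hasDerivAt hderiv (hcont.intervalIntegrable _ _)]

/-- `e^{−λ s} − e^{−λ s'} ≤ λ (s' − s)` for `0 ≤ s ≤ s'`, `0 ≤ λ` (convexity of the exponential). [cite: Evans2010, App. B.2 (Grönwall's inequality)] -/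
theorem exp_neg_mul_sub_le {lam s s' : ℝ} (hlam : 0 ≤ lam) (hs : 0 ≤ s) (hss' : s ≤ s') :
    Real.exp (-lam * s) - Real.exp (-lam * s') ≤ lam * (s' - s) := by
  have h1 : -(lam * (s' - s)) + 1 ≤ Real.exp (-(lam * (s' - s))) := Real.add_one_le_exp _
  have hpos : 0 < Real.exp (-lam * s) := Real.exp_pos _
  have hle1 : Real.exp (-lam * s) ≤ 1 := by
    rw [Real.exp_le_one_iff]
    nlinarith
  have h2 : Real.exp (-lam * s') = Real.exp (-lam * s) * Real.exp (-(lam * (s' - s))) := by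
    rw [← Real.exp_add]
    congr 1
    ring
  have h3 : Real.exp (-lam * s) * (-(lam * (s' - s)) + 1) ≤ Real.exp (-lam * s') := by
    rw [h2]
    exact mul_le_mul_of_nonneg_left h1 hpos.le
  have h4 : 0 ≤ lam * (s' - s) := mul_nonneg hlam (by linarith)
  nlinarith

/-- **Damping with an exponential envelope (a.e. two-point Grönwall with an initial value).**  Let `u ≥ 0` be integrable on
`(0,T]`, `S ⊆ (0,T]` of full measure, `0 < λ`, `0 ≤ K`, `0 ≤ c`; suppose `u(t) − u₀ ≤ ∫_{(0,t]} (K − λu)` for `t ∈ S` with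
`u₀ ≤ K/λ + c`, and `u(t) − u(s) ≤ ∫_{(s,t]} (K − λu)` for `s ≤ t` in `S`.  Then `u(t) ≤ K/λ + c·e^{−λt}` for every `t ∈ S`
(the integral form of `u' ≤ K − λu ⇒ u(t) ≤ K/λ + (u₀ − K/λ)₊ e^{−λt}`).
[cite: Evans2010, App. B.2 (Grönwall's inequality)] -/
theorem le_envelope_of_two_point_setIntegral_le {u : ℝ → ℝ} {S : Set ℝ} {T K lam c u₀ : ℝ} (hlam : 0 < lam) (hK : 0 ≤ K)
    (hc : 0 ≤ c) (hSsub : S ⊆ Ioc 0 T) (hS : ∀ᵐ r ∂(volume.restrict (Ioc 0 T)), r ∈ S)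
    (hu0 : ∀ r ∈ S, 0 ≤ u r) (hint : IntegrableOn u (Ioc 0 T))
    (hinit : u₀ ≤ K / lam + c)
    (h0 : ∀ t ∈ S, u t - u₀ ≤ ∫ r in Ioc 0 t, (K - lam * u r))
    (h2 : ∀ s ∈ S, ∀ t ∈ S, s ≤ t → u t - u s ≤ ∫ r in Ioc s t, (K - lam * u r)) :
    ∀ t ∈ S, u t ≤ K / lam + c * Real.exp (-lam * t) := by
  -- the envelope `ψ`
  obtain ⟨ψ, hψ⟩ : ∃ ψ : ℝ → ℝ, ψ = fun t => K / lam + c * Real.exp (-lam * t) := ⟨_, rfl⟩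
  have hψv : ∀ t, ψ t = K / lam + c * Real.exp (-lam * t) := fun t => by rw [hψ]
  intro t₁ ht₁
  rw [← hψv]
  by_contra hgt
  push Not at hgt
  have ht₁T : t₁ ≤ T := (hSsub ht₁).2
  have ht₁0 : 0 < t₁ := (hSsub ht₁).1
  have hS' : ∀ᵐ r ∂(volume : Measure ℝ), r ∈ Ioc 0 T → r ∈ S := (ae_restrict_iff' measurableSet_Ioc).1 hS
  -- integrability of the integrand on subintervals
  have hI : ∀ s t, 0 ≤ s → t ≤ T → IntegrableOn (fun r => K - lam * u r) (Ioc s t) := by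
    intro s t hs ht
    have hsub : Ioc s t ⊆ Ioc 0 T := fun r hr => ⟨hs.trans_lt hr.1, hr.2.trans ht⟩
    exact (integrableOn_const (by simp [Real.volume_Ioc])).sub ((hint.mono_set hsub).const_mul lam)
  have hIe : ∀ s t : ℝ, IntegrableOn (fun r => -(lam * c * Real.exp (-lam * r))) (Ioc s t) := fun s t =>
    ((continuous_const.mul (Real.continuous_exp.comp (continuous_const.mul continuous_id))).neg).integrableOn_Ioc
  -- the integrand is `≤ K` a.e.: `∫_{(s,t]} (K − λu) ≤ K (t − s) ⊔ 0`
  have hleK : ∀ s t, 0 ≤ s → t ≤ T → ∫ r in Ioc s t, (K - lam * u r) ≤ K * (t - s) ⊔ 0 := by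
    intro s t hs ht
    by_cases hst : s ≤ t
    · have h1 : ∫ r in Ioc s t, (K - lam * u r) ≤ ∫ r in Ioc s t, K := by
        refine setIntegral_mono_ae_restrict (hI s t hs ht) (integrableOn_const (by simp [Real.volume_Ioc])) ?_
        have hsub : Ioc s t ⊆ Ioc 0 T := fun r hr => ⟨hs.trans_lt hr.1, hr.2.trans ht⟩
        filter_upwards [ae_restrict_of_ae_restrict_of_subset hsub hS] with r hr
        have := hu0 r hr
        nlinarith
      rw [setIntegral_const, Real.volume_real_Ioc_of_le hst, smul_eq_mul, mul_comm] at h1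
      exact h1.trans (le_max_left _ _)
    · rw [Ioc_eq_empty (fun h => hst h.le), Measure.restrict_empty, integral_zero_measure]
      exact le_max_right _ _
  -- above the envelope the integrand is below `ψ' = −λ c e^{−λ r}`
  have habove : ∀ r, ψ r < u r → K - lam * u r ≤ -(lam * c * Real.exp (-lam * r)) := by
    intro r hr
    rw [hψv] at hr
    have h1 : K / lam * lam = K := div_mul_cancel₀ K hlam.ne'
    nlinarith
  -- the set of times `≤ t₁` in `S` at which `u` is below the envelope
  set A : Set ℝ := {s | s ∈ S ∧ s ≤ t₁ ∧ u s ≤ ψ s} with hA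
  by_cases hAne : A.Nonempty
  · -- run from the last time below the envelope
    have hAbdd : BddAbove A := ⟨t₁, fun s hs => hs.2.1⟩
    set sStar := sSup A with hsStar
    have hsStar_le : sStar ≤ t₁ := csSup_le hAne fun s hs => hs.2.1
    have hsStar_nn : 0 ≤ sStar := by
      obtain ⟨a, ha⟩ := hAne
      exact (hSsub ha.1).1.le.trans (le_csSup hAbdd ha)
    -- above `sStar` (and `≤ t₁`) the function exceeds the envelope, a.e.
    have hneg : ∫ r in Ioc sStar t₁, (K - lam * u r) ≤ ψ t₁ - ψ sStar := by
      have hmono : ∫ r in Ioc sStar t₁, (K - lam * u r) ≤ ∫ r in Ioc sStar t₁, -(lam * c * Real.exp (-lam * r)) := by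
        refine setIntegral_mono_ae_restrict (hI sStar t₁ hsStar_nn ht₁T) (hIe sStar t₁) ?_
        have hsub : Ioc sStar t₁ ⊆ Ioc 0 T := fun r hr => ⟨hsStar_nn.trans_lt hr.1, hr.2.trans ht₁T⟩
        filter_upwards [ae_restrict_of_ae_restrict_of_subset hsub hS, ae_restrict_mem measurableSet_Ioc] with r hrS hr
        have hnot : ¬ (u r ≤ ψ r) := by
          intro hle
          have hrA : r ∈ A := ⟨hrS, hr.2, hle⟩
          exact (not_le.2 hr.1) (le_csSup hAbdd hrA)
        exact habove r (not_le.1 hnot)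
      rw [setIntegral_Ioc_neg_mul_exp hsStar_le] at hmono
      rw [hψv, hψv]
      linarith
    -- for every `s ∈ A`: `u t₁ ≤ ψ s + K (sStar − s) + (ψ t₁ − ψ sStar)`
    have hkey : ∀ s ∈ A, u t₁ ≤ ψ s + K * (sStar - s) + (ψ t₁ - ψ sStar) := by
      intro s hs
      have hsS : s ∈ S := hs.1
      have hs0 : 0 ≤ s := (hSsub hsS).1.le
      have hssStar : s ≤ sStar := le_csSup hAbdd hs
      have h := h2 s hsS t₁ ht₁ hs.2.1
      have hsplit : ∫ r in Ioc s t₁, (K - lam * u r) =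
          (∫ r in Ioc s sStar, (K - lam * u r)) + ∫ r in Ioc sStar t₁, (K - lam * u r) := by
        rw [← setIntegral_union (Ioc_disjoint_Ioc_of_le le_rfl) measurableSet_Ioc
          (hI s sStar hs0 (hsStar_le.trans ht₁T)) (hI sStar t₁ hsStar_nn ht₁T),
          Ioc_union_Ioc_eq_Ioc hssStar hsStar_le]
      have h1 := hleK s sStar hs0 (hsStar_le.trans ht₁T)
      have hmax : K * (sStar - s) ⊔ 0 = K * (sStar - s) := max_eq_left (mul_nonneg hK (by linarith))
      rw [hmax] at h1
      have := hs.2.2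
      linarith [hsplit ▸ h]
    -- let `s → sStar` inside `A`: `ψ s − ψ sStar ≤ c λ (sStar − s)`
    have hlim : u t₁ ≤ ψ t₁ := by
      by_contra hc'
      push Not at hc'
      set δ := u t₁ - ψ t₁ with hδ
      have hδpos : 0 < δ := by rw [hδ]; linarith
      have hDpos : 0 < c * lam + K + 1 := by positivity
      obtain ⟨s, hsA, hs⟩ := exists_lt_of_lt_csSup hAne (sub_lt_self sStar (div_pos hδpos hDpos))
      have hs0 : 0 ≤ s := (hSsub hsA.1).1.le
      have hssStar : s ≤ sStar := le_csSup hAbdd hsA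
      have hψs : ψ s - ψ sStar ≤ c * lam * (sStar - s) := by
        rw [hψv, hψv]
        have := exp_neg_mul_sub_le hlam.le hs0 hssStar
        nlinarith
      have h1 := hkey s hsA
      have hlt : (c * lam + K) * (sStar - s) < (c * lam + K + 1) * (δ / (c * lam + K + 1)) := by
        have hgap : sStar - s < δ / (c * lam + K + 1) := by linarith
        calc (c * lam + K) * (sStar - s) ≤ (c * lam + K + 1) * (sStar - s) :=
              mul_le_mul_of_nonneg_right (by linarith) (by linarith)
          _ < (c * lam + K + 1) * (δ / (c * lam + K + 1)) := mul_lt_mul_of_pos_left hgap hDpos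
      rw [mul_div_cancel₀ δ hDpos.ne'] at hlt
      nlinarith
    exact (not_lt.2 hlim) hgt
  · -- no time `≤ t₁` below the envelope: the integrand is below `ψ'` a.e. on `(0,t₁]`
    have hneg : ∫ r in Ioc 0 t₁, (K - lam * u r) ≤ ψ t₁ - ψ 0 := by
      have hmono : ∫ r in Ioc 0 t₁, (K - lam * u r) ≤ ∫ r in Ioc 0 t₁, -(lam * c * Real.exp (-lam * r)) := by
        refine setIntegral_mono_ae_restrict (hI 0 t₁ le_rfl ht₁T) (hIe 0 t₁) ?_
        have hsub : Ioc 0 t₁ ⊆ Ioc 0 T := fun r hr => ⟨hr.1, hr.2.trans ht₁T⟩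
        filter_upwards [ae_restrict_of_ae_restrict_of_subset hsub hS, ae_restrict_mem measurableSet_Ioc] with r hrS hr
        have hnot : ¬ (u r ≤ ψ r) := fun hle => hAne ⟨r, hrS, hr.2, hle⟩
        exact habove r (not_le.1 hnot)
      rw [setIntegral_Ioc_neg_mul_exp ht₁0.le] at hmono
      rw [hψv, hψv]
      linarith
    have h := h0 t₁ ht₁
    have hψ0 : ψ 0 = K / lam + c := by rw [hψv]; simp
    linarith

end Literature.Analysis.ODE

end
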